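/-
Copyright (c) 2026 the pub-hodgecm-mathlib formalisation cell (harness21).  Prover seat hodgecm-mathlib-K2E3-p12 (g4), Track B «K2-LIT» ∕ h413
(`stmt-HodgeConjecture-24833`), line `K2_E3_EllipticInputs`, unit U12-d, §L (Gp-a, FILE 3): THE STRUCTURE OF `J(𝒩)^{Gp}(𝔤𝔩₂(F))` — a `Gp`-invariant distribution supported on the
nilpotent cone is `a·δ₀ + Σ_𝒪 c_𝒪·ν|_𝒪` over the (finitely many) `Gp`-orbits of `𝒩 ∖ {0}`, for any OPEN `Gp ≤ GL₂(F)`.  2026-09-04.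
-/
import Summits.HodgeConjecture.HodgeConjecture.Theorems.K2E3GL2NilpotentSubgroupOrbitUniqueness    -- (Gp-a) FILE 2 (this seat): `subgroupOrbit_uniqueness`
import HarnessLib

/-!
# K2_E3 road (h413), §L — (Gp-a) FILE 3: `J(𝒩)^{Gp}(𝔤𝔩₂(F)) = ℂδ₀ ⊕ ⊕_𝒪 ℂ·ν|_𝒪` for an open subgroup `Gp ≤ GL₂(F)` with finitely many nilpotent orbits

Cell `pub/hodgecm-mathlib` (D-0151), Track B, seat K2E3-p12 (g4), §L line lead (§L RULINGS #2∕#3; MEMO v3 76bc1f2b, road «U-iso-T»).  `--supports stmt-HodgeConjecture-24833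
--as helper`; THEOREMS ONLY (no definition ∕ instance ∕ notation ∕ named fact ∕ `sorry`); never imports `Cruxes/…/Lines`.  COUNT-NEUTRAL.

THE STATEMENT (`nilpotentStructure_of_subgroupOrbits`).  `Gp ≤ GL₂(F)` open; `x : ι → 𝔤𝔩₂(F)` (`ι` finite) non-zero nilpotent representatives of PAIRWISE DISJOINT `Gp`-orbits
`𝒪ᵢ = Gp • xᵢ` COVERING `𝒩 ∖ {0}`; `(κ, dx)` a Haar pair; `T` additive, homogeneous, `Ad(Gp)`-invariant, zero on test functions whose support meets no nilpotent.  THEN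
`∃ a, ∃ c : ι → ℂ, ∀ f ∈ C_c^∞(𝔤𝔩₂(F)), T f = a·f(0) + Σᵢ cᵢ · ∫_{chart⁻¹ 𝒪ᵢ} f(k (tE₁₂) k⁻¹) d(κ ⊗ dx)`.  Instances: `Gp = GL₂(F)`, one orbit (★ S2c∕(LBGL-2a));
`Gp = G⁺ = det⁻¹(Nm Eˣ)`, two orbits `𝒪_±` (the isotropic `U(1,1)` half of (L-B_U)′ after transport, MEMO v3 (G⁺-a)).
[HarishChandra1999AdmissibleDistributions, §3 Thm. 3.9, Cor. 3.10 p. 10 («`dim J(𝒩)` = number of nilpotent orbits»)]; [Howe1974, Prop. 2]; [BernsteinZelevinsky1976, §1.18].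

THE PROOF.  `cᵢ` from ★ FILE 2 on each orbit; `M f := Σᵢ cᵢ ν|_{𝒪ᵢ}(f)` is additive and homogeneous (★ `integrable_comp_conjNilp`).  CLAIM `T f = M f` whenever `0 ∉ tsupport f`:
induction on a finset `s` of orbits allowed to meet `tsupport f` — if `tsupport f ∩ 𝒩 ⊆ 𝒪ᵢ` both sides are `cᵢ ν|_{𝒪ᵢ}(f)` (FILE 2; the other orbits miss `supp f`); in
general cut `f = 1_W f + 1_{Wᶜ} f` with a compact open `W ⊇ tsupport f ∩ 𝒪ᵢ` inside `(𝒩 ∖ 𝒪ᵢ)ᶜ` (★ FILE 1: `𝒩 ∖ 𝒪ᵢ` closed, `𝒪ᵢ` closed in `𝒩 ∖ {0}`;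
★ `exists_isCompact_isOpen_superset_subset`): the first piece meets `𝒩` inside `𝒪ᵢ`, the second inside the remaining orbits.  Then ★ p856851
`apply_eq_delta_add_of_eq_off_point` («`T = M` off `0` ⇒ `T = a·δ₀ + M`»).

References: [HarishChandra1999AdmissibleDistributions] Harish-Chandra (DeBacker–Sally), AMS ULECT 16 (1999), §3 pp. 8–10 · [Howe1974] Math. Ann. 208 (1974), Prop. 2 ·
[BernsteinZelevinsky1976] Russian Math. Surveys 31:3 (1976), §1.18.
-/

set_option autoImplicit false
set_option linter.dupNamespace false   -- `Summit.HodgeConjecture.HodgeConjecture.…` (D-0017 nested layout; lakefile exemption for Summits)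

noncomputable section

open MeasureTheory Measure Filter Topology TopologicalSpace
open scoped MatrixGroups NNReal ENNReal
open Literature.NumberTheory.Rogawski1990 Literature.NumberTheory.Automorphic Literature.NumberTheory.Automorphic.LocalFieldHaar
open Literature.NumberTheory.GaloisRepresentations Literature.NumberTheory.GaloisRepresentations.IsNonarchimedeanLocalField
open Summit.HodgeConjecture.HodgeConjecture.Cruxes.H413.K2E3GLnNilpotentFourierPointSupport
open Summit.HodgeConjecture.HodgeConjecture.Cruxes.H413.K2E3GL2RegularNilpotentOrbitalMeasure
open Summit.HodgeConjecture.HodgeConjecture.Cruxes.H413.K2E3GL2RegularNilpotentOrbitStructure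
open Summit.HodgeConjecture.HodgeConjecture.Cruxes.H413.K2E3GL2RegularNilpotentOrbitSpace
open Summit.HodgeConjecture.HodgeConjecture.Cruxes.H413.K2E3GL2NilpotentStructureOfPuncturedCone
open Summit.HodgeConjecture.HodgeConjecture.Cruxes.H413.K2E3GL2NilpotentSubgroupOrbitSpace
open Summit.HodgeConjecture.HodgeConjecture.Cruxes.H413.K2E3GL2NilpotentSubgroupOrbitUniqueness

namespace Summit.HodgeConjecture.HodgeConjecture.Cruxes.H413.K2E3GL2NilpotentStructureOfSubgroupOrbits

variable {F : Type*} [Field F] [ValuativeRel F] [TopologicalSpace F] [IsNonarchimedeanLocalField F]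
  (Gp : Subgroup (ConjAct (GL (Fin 2) F)))

/-! ## §1  Cutting a test function along one `Gp`-orbit -/

/-- **A compact open neighbourhood of `tsupport f ∩ 𝒪` meeting the nilpotent cone only inside `𝒪`**, for `f ∈ C_c^∞(𝔤𝔩₂(F))` with `0 ∉ tsupport f`
(`tsupport f ∩ 𝒪 = tsupport f ∩ closure 𝒪` is compact and disjoint from the closed `𝒩 ∖ 𝒪`, ★ FILE 1; ★ `exists_isCompact_isOpen_superset_subset`).
[cite: BernsteinZelevinsky1976, §1.1] [cite: HarishChandra1999AdmissibleDistributions, §3 p. 10] -/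
theorem exists_isCompact_isOpen_cut (hGp : IsOpen {g : GL (Fin 2) F | ConjAct.toConjAct g ∈ Gp}) {x₀ : Matrix (Fin 2) (Fin 2) F}
    (hx₀ : IsNilpotent x₀) (h0 : x₀ ≠ 0) {f : Matrix (Fin 2) (Fin 2) F → ℂ} (hf : IsLocSmooth f) (hf0 : (0 : Matrix (Fin 2) (Fin 2) F) ∉ tsupport f) :
    ∃ W : Set (Matrix (Fin 2) (Fin 2) F), IsCompact W ∧ IsOpen W ∧ (∀ X ∈ W, IsNilpotent X → X ∈ MulAction.orbit ↥Gp x₀) ∧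
      ∀ X ∈ tsupport f, X ∈ MulAction.orbit ↥Gp x₀ → X ∈ W := by
  haveI : T2Space F := (isLocalField F).toT2Space
  haveI : LocallyCompactSpace F := (isLocalField F).toLocallyCompactSpace
  haveI : LocallyCompactSpace (Matrix (Fin 2) (Fin 2) F) := Pi.locallyCompactSpace_of_finite
  haveI : TotallyDisconnectedSpace F := totallyDisconnectedSpace_of_isNonarchimedeanLocalField F
  haveI : TotallyDisconnectedSpace (Matrix (Fin 2) (Fin 2) F) := inferInstanceAs (TotallyDisconnectedSpace (Fin 2 → Fin 2 → F))
  -- `K = tsupport f ∩ 𝒪 = tsupport f ∩ closure 𝒪` is compact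
  have hKeq : tsupport f ∩ MulAction.orbit ↥Gp x₀ = tsupport f ∩ closure (MulAction.orbit ↥Gp x₀) := by
    apply Set.Subset.antisymm (Set.inter_subset_inter_right _ subset_closure)
    rintro X ⟨hX, hXc⟩
    refine ⟨hX, ?_⟩
    rcases closure_orbit_subgroup_subset Gp hGp hx₀ h0 hXc with h | h
    · exact absurd hX (by rw [h]; exact hf0)
    · exact h
  have hKc : IsCompact (tsupport f ∩ MulAction.orbit ↥Gp x₀) := by
    rw [hKeq]; exact hf.2.inter_right isClosed_closure
  have hZ := isClosed_setOf_isNilpotent_diff_orbit_subgroup Gp hGp hx₀ h0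
  have hKZ : tsupport f ∩ MulAction.orbit ↥Gp x₀ ⊆ ({N : Matrix (Fin 2) (Fin 2) F | IsNilpotent N} \ MulAction.orbit ↥Gp x₀)ᶜ :=
    fun X hX hXZ => hXZ.2 hX.2
  obtain ⟨W, hWc, hWo, hKW, hWZ⟩ := Literature.Topology.exists_isCompact_isOpen_superset_subset hKc hZ.isOpen_compl hKZ
  refine ⟨W, hWc, hWo, fun X hXW hXn => ?_, fun X hX hXO => hKW ⟨hX, hXO⟩⟩
  by_contra hXO
  exact hWZ hXW ⟨hXn, hXO⟩

/-! ## §2  The structure theorem -/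

set_option maxHeartbeats 1600000 in
/-- **STRUCTURE OF `J(𝒩)^{Gp}(𝔤𝔩₂(F))`.**  `Gp ≤ GL₂(F)` open; `xᵢ` (`i ∈ ι`, finite) non-zero nilpotent representatives of pairwise disjoint `Gp`-orbits covering `𝒩 ∖ {0}`;
`(κ, dx)` a Haar pair on `GL₂(𝒪_F) × F`; `T` additive, homogeneous, `Ad(Gp)`-invariant, zero on test functions whose support meets no nilpotent.  Then
`T f = a·f(0) + Σᵢ cᵢ · ∫_{chart⁻¹ (Gp • xᵢ)} f(k (tE₁₂) k⁻¹) d(κ ⊗ dx)` on `C_c^∞(𝔤𝔩₂(F))` — `J(𝒩)^{Gp}` is spanned by `δ₀` and the `Gp`-orbital integrals of the nilpotent orbits.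
[cite: HarishChandra1999AdmissibleDistributions, Thm. 3.9, Cor. 3.10 p. 10] [cite: Howe1974, Prop. 2] [cite: BernsteinZelevinsky1976, §1.18] -/
theorem nilpotentStructure_of_subgroupOrbits (hGp : IsOpen {g : GL (Fin 2) F | ConjAct.toConjAct g ∈ Gp})
    {ι : Type*} [Fintype ι] (x : ι → Matrix (Fin 2) (Fin 2) F) (hx : ∀ i, IsNilpotent (x i)) (hx0 : ∀ i, x i ≠ 0)
    (hcover : ∀ X : Matrix (Fin 2) (Fin 2) F, IsNilpotent X → X ≠ 0 → ∃ i, X ∈ MulAction.orbit ↥Gp (x i))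
    (hdisj : ∀ i j, i ≠ j → Disjoint (MulAction.orbit ↥Gp (x i)) (MulAction.orbit ↥Gp (x j)))
    [MeasurableSpace F] [BorelSpace F] [MeasurableSpace (GL (Fin 2) F)] [BorelSpace (GL (Fin 2) F)]
    (κ : Measure ↥(glInt 2 F)) [IsHaarMeasure κ] (dx : Measure F) [dx.IsAddHaarMeasure]
    (T : (Matrix (Fin 2) (Fin 2) F → ℂ) → ℂ)
    (hT1 : ∀ f₁ f₂ : Matrix (Fin 2) (Fin 2) F → ℂ, IsLocSmooth f₁ → IsLocSmooth f₂ → T (f₁ + f₂) = T f₁ + T f₂)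
    (hT2 : ∀ (a : ℂ) (f : Matrix (Fin 2) (Fin 2) F → ℂ), IsLocSmooth f → T (a • f) = a * T f)
    (hT3 : ∀ g : GL (Fin 2) F, ConjAct.toConjAct g ∈ Gp → ∀ f : Matrix (Fin 2) (Fin 2) F → ℂ, IsLocSmooth f →
      T (fun X => f ((g : Matrix (Fin 2) (Fin 2) F) * X * ((g⁻¹ : GL (Fin 2) F) : Matrix (Fin 2) (Fin 2) F))) = T f)
    (hT4 : ∀ f : Matrix (Fin 2) (Fin 2) F → ℂ, IsLocSmooth f → (∀ X ∈ tsupport f, ¬ IsNilpotent X) → T f = 0) :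
    ∃ (a : ℂ) (c : ι → ℂ), ∀ f : Matrix (Fin 2) (Fin 2) F → ℂ, IsLocSmooth f →
      T f = a * f 0 + ∑ i, c i * ∫ p in {p : ↥(glInt 2 F) × F | ((p.1 : GL (Fin 2) F) : Matrix (Fin 2) (Fin 2) F) * !![0, p.2; 0, 0] *
          ((((p.1 : GL (Fin 2) F))⁻¹ : GL (Fin 2) F) : Matrix (Fin 2) (Fin 2) F) ∈ MulAction.orbit ↥Gp (x i)},
        f (((p.1 : GL (Fin 2) F) : Matrix (Fin 2) (Fin 2) F) * !![0, p.2; 0, 0] * ((((p.1 : GL (Fin 2) F))⁻¹ : GL (Fin 2) F) : Matrix (Fin 2) (Fin 2) F)) ∂(κ.prod dx) := by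
  classical
  haveI : T2Space F := (isLocalField F).toT2Space
  -- the constants on each orbit (★ FILE 2)
  have hc : ∀ i, ∃ c : ℂ, ∀ f : Matrix (Fin 2) (Fin 2) F → ℂ, IsLocSmooth f → (∀ X ∈ tsupport f, IsNilpotent X → X ∈ MulAction.orbit ↥Gp (x i)) →
      T f = c * ∫ p in {p : ↥(glInt 2 F) × F | ((p.1 : GL (Fin 2) F) : Matrix (Fin 2) (Fin 2) F) * !![0, p.2; 0, 0] *
          ((((p.1 : GL (Fin 2) F))⁻¹ : GL (Fin 2) F) : Matrix (Fin 2) (Fin 2) F) ∈ MulAction.orbit ↥Gp (x i)},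
        f (((p.1 : GL (Fin 2) F) : Matrix (Fin 2) (Fin 2) F) * !![0, p.2; 0, 0] * ((((p.1 : GL (Fin 2) F))⁻¹ : GL (Fin 2) F) : Matrix (Fin 2) (Fin 2) F)) ∂(κ.prod dx) :=
    fun i => subgroupOrbit_uniqueness Gp hGp (hx i) (hx0 i) κ dx T hT1 hT2 hT3 hT4
  choose c hc using hc
  -- the orbital integrals `I i f` and the model functional `M f = Σ c i · I i f`
  obtain ⟨I, hI⟩ : ∃ I : ι → (Matrix (Fin 2) (Fin 2) F → ℂ) → ℂ, ∀ i f, I i f =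
      ∫ p in {p : ↥(glInt 2 F) × F | ((p.1 : GL (Fin 2) F) : Matrix (Fin 2) (Fin 2) F) * !![0, p.2; 0, 0] *
          ((((p.1 : GL (Fin 2) F))⁻¹ : GL (Fin 2) F) : Matrix (Fin 2) (Fin 2) F) ∈ MulAction.orbit ↥Gp (x i)},
        f (((p.1 : GL (Fin 2) F) : Matrix (Fin 2) (Fin 2) F) * !![0, p.2; 0, 0] * ((((p.1 : GL (Fin 2) F))⁻¹ : GL (Fin 2) F) : Matrix (Fin 2) (Fin 2) F)) ∂(κ.prod dx) :=
    ⟨_, fun _ _ => rfl⟩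
  obtain ⟨M, hM⟩ : ∃ M : (Matrix (Fin 2) (Fin 2) F → ℂ) → ℂ, ∀ f, M f = ∑ i, c i * I i f := ⟨_, fun _ => rfl⟩
  -- `I i` kills functions vanishing on `𝒪ᵢ`
  have hI0 : ∀ i (f : Matrix (Fin 2) (Fin 2) F → ℂ), (∀ X ∈ MulAction.orbit ↥Gp (x i), f X = 0) → I i f = 0 := by
    intro i f hfi
    rw [hI]
    exact setIntegral_eq_zero_of_forall_eq_zero fun p hp => hfi _ hp
  -- `M` is additive and homogeneous on `C_c^∞`
  have hIadd : ∀ i (f₁ f₂ : Matrix (Fin 2) (Fin 2) F → ℂ), IsLocSmooth f₁ → IsLocSmooth f₂ → I i (f₁ + f₂) = I i f₁ + I i f₂ := by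
    intro i f₁ f₂ h₁ h₂
    rw [hI, hI, hI]
    simp only [Pi.add_apply]
    exact integral_add (integrable_comp_conjNilp κ dx h₁).integrableOn (integrable_comp_conjNilp κ dx h₂).integrableOn
  have hIsmul : ∀ i (a : ℂ) (f : Matrix (Fin 2) (Fin 2) F → ℂ), I i (a • f) = a * I i f := by
    intro i a f
    rw [hI, hI]
    simp only [Pi.smul_apply, smul_eq_mul]
    exact integral_const_mul a _
  have hMadd : ∀ f₁ f₂ : Matrix (Fin 2) (Fin 2) F → ℂ, IsLocSmooth f₁ → IsLocSmooth f₂ → M (f₁ + f₂) = M f₁ + M f₂ := by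
    intro f₁ f₂ h₁ h₂
    rw [hM, hM, hM, ← Finset.sum_add_distrib]
    exact Finset.sum_congr rfl fun i _ => by rw [hIadd i _ _ h₁ h₂, mul_add]
  have hMsmul : ∀ (a : ℂ) (f : Matrix (Fin 2) (Fin 2) F → ℂ), IsLocSmooth f → M (a • f) = a * M f := by
    intro a f _
    rw [hM, hM, Finset.mul_sum]
    exact Finset.sum_congr rfl fun i _ => by rw [hIsmul]; ring
  -- ONE ORBIT: if `tsupport f ∩ 𝒩 ⊆ 𝒪ᵢ` then `T f = M f = cᵢ · I i f`
  have hone : ∀ i (f : Matrix (Fin 2) (Fin 2) F → ℂ), IsLocSmooth f → (∀ X ∈ tsupport f, IsNilpotent X → X ∈ MulAction.orbit ↥Gp (x i)) → T f = M f := by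
    intro i f hf hfi
    rw [hc i f hf hfi, hM, Finset.sum_eq_single i]
    · rw [hI]
    · intro j _ hji
      rw [hI0 j f, mul_zero]
      intro X hXj
      by_contra hfX
      have hXi := hfi X (subset_tsupport f (Function.mem_support.2 hfX)) (isNilpotent_and_ne_zero_of_mem_orbit_subgroup Gp (hx j) (hx0 j) hXj).1
      exact Set.disjoint_left.1 (hdisj i j (Ne.symm hji)) hXi hXj
    · intro hi; exact absurd (Finset.mem_univ i) hi
  -- NO ORBIT: if `tsupport f` meets no nilpotent then `T f = 0 = M f`
  have hnone : ∀ f : Matrix (Fin 2) (Fin 2) F → ℂ, IsLocSmooth f → (∀ X ∈ tsupport f, ¬ IsNilpotent X) → T f = M f := by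
    intro f hf hfn
    rw [hT4 f hf hfn, hM]
    symm
    refine Finset.sum_eq_zero fun i _ => ?_
    rw [hI0 i f, mul_zero]
    intro X hXi
    by_contra hfX
    exact hfn X (subset_tsupport f (Function.mem_support.2 hfX)) (isNilpotent_and_ne_zero_of_mem_orbit_subgroup Gp (hx i) (hx0 i) hXi).1
  -- INDUCTION on the set of orbits allowed to meet `tsupport f` (for `0 ∉ tsupport f`)
  have key : ∀ s : Finset ι, ∀ f : Matrix (Fin 2) (Fin 2) F → ℂ, IsLocSmooth f → (0 : Matrix (Fin 2) (Fin 2) F) ∉ tsupport f →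
      (∀ X ∈ tsupport f, IsNilpotent X → ∃ i ∈ s, X ∈ MulAction.orbit ↥Gp (x i)) → T f = M f := by
    intro s
    induction s using Finset.induction_on with
    | empty =>
      intro f hf _ hfs
      exact hnone f hf fun X hX hXn => by obtain ⟨i, hi, -⟩ := hfs X hX hXn; exact absurd hi (Finset.notMem_empty i)
    | insert i s his ih =>
      intro f hf hf0 hfs
      obtain ⟨W, hWc, hWo, hWO, hOW⟩ := exists_isCompact_isOpen_cut Gp hGp (hx i) (hx0 i) hf hf0
      have hW1 : IsLocSmooth (W.indicator f) := hf.indicator ⟨hWc.isClosed, hWo⟩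
      have hW2 : IsLocSmooth (Wᶜ.indicator f) := hf.indicator ⟨hWo.isClosed_compl, hWc.isClosed.isOpen_compl⟩
      have hsplit : f = W.indicator f + Wᶜ.indicator f := (Set.indicator_self_add_compl W f).symm
      -- the piece on `W` meets `𝒩` inside `𝒪ᵢ`
      have h1 : T (W.indicator f) = M (W.indicator f) := by
        refine hone i _ hW1 fun X hX hXn => hWO X (tsupport_indicator_subset_of_isClosed f hWc.isClosed hX) hXn
      -- the piece off `W` meets `𝒩` inside the orbits of `s`
      have h2 : T (Wᶜ.indicator f) = M (Wᶜ.indicator f) := by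
        refine ih _ hW2 (fun h => hf0 (tsupport_indicator_subset_tsupport f _ h)) fun X hX hXn => ?_
        have hXf : X ∈ tsupport f := tsupport_indicator_subset_tsupport f _ hX
        have hXW : X ∉ W := tsupport_indicator_subset_of_isClosed f hWo.isClosed_compl hX
        obtain ⟨j, hj, hXj⟩ := hfs X hXf hXn
        rcases Finset.mem_insert.1 hj with rfl | hj'
        · exact absurd (hOW X hXf hXj) hXW
        · exact ⟨j, hj', hXj⟩
      calc T f = T (W.indicator f + Wᶜ.indicator f) := by rw [← hsplit]
        _ = T (W.indicator f) + T (Wᶜ.indicator f) := hT1 _ _ hW1 hW2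
        _ = M (W.indicator f) + M (Wᶜ.indicator f) := by rw [h1, h2]
        _ = M (W.indicator f + Wᶜ.indicator f) := (hMadd _ _ hW1 hW2).symm
        _ = M f := by rw [← hsplit]
  -- OFF ZERO: `T f = M f` whenever `0 ∉ tsupport f`
  have hoff : ∀ f : Matrix (Fin 2) (Fin 2) F → ℂ, IsLocSmooth f → (0 : Matrix (Fin 2) (Fin 2) F) ∉ tsupport f → T f = 1 * M f := by
    intro f hf hf0
    rw [one_mul]
    refine key Finset.univ f hf hf0 fun X hX hXn => ?_
    have hX0 : X ≠ 0 := fun h => hf0 (h ▸ hX)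
    obtain ⟨i, hi⟩ := hcover X hXn hX0
    exact ⟨i, Finset.mem_univ i, hi⟩
  -- ★ p856851 §1: `T = M` off `0` ⇒ `T = a·δ₀ + M`
  obtain ⟨hΛo, hΛc, hΛ0⟩ := isOpen_isCompact_matrixIntegerBox (F := F) (N := 2)
  refine ⟨T ({X : Matrix (Fin 2) (Fin 2) F | ∀ i j, X i j ∈ primePowBall F 0}.indicator fun _ => (1 : ℂ)) -
      1 * M ({X : Matrix (Fin 2) (Fin 2) F | ∀ i j, X i j ∈ primePowBall F 0}.indicator fun _ => (1 : ℂ)), c, fun f hf => ?_⟩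
  have h := apply_eq_delta_add_of_eq_off_point hΛo hΛc hΛ0 T M hT1 hT2 hMadd hMsmul 1 hoff hf
  rw [h]
  simp only [one_mul, hM, hI]

end Summit.HodgeConjecture.HodgeConjecture.Cruxes.H413.K2E3GL2NilpotentStructureOfSubgroupOrbits
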